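import Summits.ResolutionOfSingularities.ResolutionOfSingularities.Theorems.ConeExit.Negative.Mirror

/-!
# `ConeExit` (crux stmt-ResolutionOfSingularities-16883, route `WildCones`): the `p = 2` contact-form
# START state, certified (negative-side support, refuter cdisprove seat; this file refutes nothing)

Data and kernel certificates for the planner's `p = 2` witness against the crux body (item note of
stmt-16883), over the exact mirror `Negative/Mirror.lean` of the crux's calculus: the start
`contact = u₁u₂ + u₃²u₄ + u₄⁵ + u₃⁷` over `𝔽₂` (`n = 4`) is `2`-clean, has multiplicity `2`
(`multP_contact`), tangent cone `X₀X₁` (`cone_contact`), cone-invariance space containing `e₃, e₄`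
(`two_le_dL_contact : 2 ≤ dL`), and is ISOLATED (`isol_contact`: `∂a = (u₂, u₁, u₃⁶, u₄⁴ + u₃²)`, so
`X_k^12 ∈ (∂a)`; certificate format `module_finite_quotient_of_X_pow_mem`). The successor and the
negative lemma `coneExit_false_without_PNe2` are in `Negative/FalseWithoutPNe2.lean`.
-/

noncomputable section

-- single-problem summit: the doubled namespace component `ResolutionOfSingularities` is forced by the tree layout
set_option linter.dupNamespace false

namespace Summit.ResolutionOfSingularities.ResolutionOfSingularities.Theorems.ConeExit.Negative

open scoped BigOperators Classical
open MvPowerSeries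

/-- Coefficients of a product of two powers of variables. [folklore] -/
lemma coeff_X_pow_mul' {σ : Type} [DecidableEq σ] {R : Type} [CommSemiring R] (A : σ →₀ ℕ)
    (i j : σ) (a b : ℕ) :
    coeff A ((X i : MvPowerSeries σ R) ^ a * X j ^ b) =
      if A = Finsupp.single i a + Finsupp.single j b then 1 else 0 := by
  rw [X_pow_eq, X_pow_eq, monomial_mul_monomial, one_mul, coeff_monomial]

/-- The planner's contact-form start `a = u₁u₂ + u₃²u₄ + u₄⁵ + u₃⁷` over `𝔽₂` (`u_{j+1} ↔ j`), as a
coefficient function. [folklore] -/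
def contact : (Fin 4 → ℕ) → ZMod 2 :=
  fun A =>
    if A 0 = 0 ∧ A 1 = 0 ∧ A 2 = 0 ∧ A 3 = 5 then 1
    else if A 0 = 0 ∧ A 1 = 0 ∧ A 2 = 2 ∧ A 3 = 1 then 1
    else if A 0 = 0 ∧ A 1 = 0 ∧ A 2 = 7 ∧ A 3 = 0 then 1
    else if A 0 = 1 ∧ A 1 = 1 ∧ A 2 = 0 ∧ A 3 = 0 then 1
    else 0


/-- Support of `contact`. [folklore] -/
lemma contact_ne_zero_iff (A : Fin 4 → ℕ) :
    contact A ≠ 0 ↔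
      (A 0 = 0 ∧ A 1 = 0 ∧ A 2 = 0 ∧ A 3 = 5) ∨
      (A 0 = 0 ∧ A 1 = 0 ∧ A 2 = 2 ∧ A 3 = 1) ∨
      (A 0 = 0 ∧ A 1 = 0 ∧ A 2 = 7 ∧ A 3 = 0) ∨
      (A 0 = 1 ∧ A 1 = 1 ∧ A 2 = 0 ∧ A 3 = 0) := by
  constructor
  · intro h
    unfold contact at h
    split_ifs at h with h1 h2 h3 h4
    · exact Or.inl h1
    · exact Or.inr (Or.inl h2)
    · exact Or.inr (Or.inr (Or.inl h3))
    · exact Or.inr (Or.inr (Or.inr h4))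
    · exact absurd rfl h
  · intro h
    unfold contact
    split_ifs <;> first | exact one_ne_zero | (exfalso; omega)


/-- `contact` is `2`-clean (every monomial has an odd exponent). [folklore] -/
lemma clean_contact : clean 2 contact = contact := by
  funext A
  unfold clean
  split_ifs with h
  · symm
    by_contra hne
    rcases (contact_ne_zero_iff A).mp hne with hA | hA | hA | hA
    · have := h 3; omega
    · have := h 3; omega
    · have := h 2; omega
    · have := h 0; omega
  · rfl


/-- `∂_0` of `contact` over `𝔽₂`. [folklore] -/
lemma pd0_contact : pd 0 (ser 2 contact) = (X 1 : MvPowerSeries (Fin 4) (ZMod 2)) := by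
  ext A
  rw [coeff_pd_ser, coeff_ser, clean_contact, coeff_X]
  have e0 : (A + Finsupp.single (0 : Fin 4) 1 : Fin 4 →₀ ℕ) 0 = A 0 + 1 := by simp
  have e1 : (A + Finsupp.single (0 : Fin 4) 1 : Fin 4 →₀ ℕ) 1 = A 1 := by simp
  have e2 : (A + Finsupp.single (0 : Fin 4) 1 : Fin 4 →₀ ℕ) 2 = A 2 := by simp
  have e3 : (A + Finsupp.single (0 : Fin 4) 1 : Fin 4 →₀ ℕ) 3 = A 3 := by simp
  have hT0 : A = Finsupp.single (1 : Fin 4) 1 ↔ A 0 = 0 ∧ A 1 = 1 ∧ A 2 = 0 ∧ A 3 = 0 := by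
    constructor
    · intro h; subst h; simp
    · rintro ⟨h0, h1, h2, h3⟩; ext j; fin_cases j <;> simp [h0, h1, h2, h3]
  unfold contact
  simp only [e0, e1, e2, e3]
  by_cases hc0 : A 0 = 0 ∧ A 1 = 1 ∧ A 2 = 0 ∧ A 3 = 0
  · rw [if_pos (hT0.mpr hc0),
      if_neg (show ¬ (A 0 + 1 = 0 ∧ A 1 = 0 ∧ A 2 = 0 ∧ A 3 = 5) by omega),
      if_neg (show ¬ (A 0 + 1 = 0 ∧ A 1 = 0 ∧ A 2 = 2 ∧ A 3 = 1) by omega),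
      if_neg (show ¬ (A 0 + 1 = 0 ∧ A 1 = 0 ∧ A 2 = 7 ∧ A 3 = 0) by omega),
      if_pos (show A 0 + 1 = 1 ∧ A 1 = 1 ∧ A 2 = 0 ∧ A 3 = 0 by omega)]
    rw [show A 0 = 0 by omega]; decide
  · rw [if_neg (show ¬ (A = Finsupp.single (1 : Fin 4) 1) from fun h' => by have := hT0.mp h'; omega),
      if_neg (show ¬ (A 0 + 1 = 0 ∧ A 1 = 0 ∧ A 2 = 0 ∧ A 3 = 5) by omega),
      if_neg (show ¬ (A 0 + 1 = 0 ∧ A 1 = 0 ∧ A 2 = 2 ∧ A 3 = 1) by omega),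
      if_neg (show ¬ (A 0 + 1 = 0 ∧ A 1 = 0 ∧ A 2 = 7 ∧ A 3 = 0) by omega),
      if_neg (show ¬ (A 0 + 1 = 1 ∧ A 1 = 1 ∧ A 2 = 0 ∧ A 3 = 0) by omega),
      mul_zero]

/-- `∂_1` of `contact` over `𝔽₂`. [folklore] -/
lemma pd1_contact : pd 1 (ser 2 contact) = (X 0 : MvPowerSeries (Fin 4) (ZMod 2)) := by
  ext A
  rw [coeff_pd_ser, coeff_ser, clean_contact, coeff_X]
  have e0 : (A + Finsupp.single (1 : Fin 4) 1 : Fin 4 →₀ ℕ) 0 = A 0 := by simp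
  have e1 : (A + Finsupp.single (1 : Fin 4) 1 : Fin 4 →₀ ℕ) 1 = A 1 + 1 := by simp
  have e2 : (A + Finsupp.single (1 : Fin 4) 1 : Fin 4 →₀ ℕ) 2 = A 2 := by simp
  have e3 : (A + Finsupp.single (1 : Fin 4) 1 : Fin 4 →₀ ℕ) 3 = A 3 := by simp
  have hT0 : A = Finsupp.single (0 : Fin 4) 1 ↔ A 0 = 1 ∧ A 1 = 0 ∧ A 2 = 0 ∧ A 3 = 0 := by
    constructor
    · intro h; subst h; simp
    · rintro ⟨h0, h1, h2, h3⟩; ext j; fin_cases j <;> simp [h0, h1, h2, h3]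
  unfold contact
  simp only [e0, e1, e2, e3]
  by_cases hc0 : A 0 = 1 ∧ A 1 = 0 ∧ A 2 = 0 ∧ A 3 = 0
  · rw [if_pos (hT0.mpr hc0),
      if_neg (show ¬ (A 0 = 0 ∧ A 1 + 1 = 0 ∧ A 2 = 0 ∧ A 3 = 5) by omega),
      if_neg (show ¬ (A 0 = 0 ∧ A 1 + 1 = 0 ∧ A 2 = 2 ∧ A 3 = 1) by omega),
      if_neg (show ¬ (A 0 = 0 ∧ A 1 + 1 = 0 ∧ A 2 = 7 ∧ A 3 = 0) by omega),
      if_pos (show A 0 = 1 ∧ A 1 + 1 = 1 ∧ A 2 = 0 ∧ A 3 = 0 by omega)]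
    rw [show A 1 = 0 by omega]; decide
  · rw [if_neg (show ¬ (A = Finsupp.single (0 : Fin 4) 1) from fun h' => by have := hT0.mp h'; omega),
      if_neg (show ¬ (A 0 = 0 ∧ A 1 + 1 = 0 ∧ A 2 = 0 ∧ A 3 = 5) by omega),
      if_neg (show ¬ (A 0 = 0 ∧ A 1 + 1 = 0 ∧ A 2 = 2 ∧ A 3 = 1) by omega),
      if_neg (show ¬ (A 0 = 0 ∧ A 1 + 1 = 0 ∧ A 2 = 7 ∧ A 3 = 0) by omega),
      if_neg (show ¬ (A 0 = 1 ∧ A 1 + 1 = 1 ∧ A 2 = 0 ∧ A 3 = 0) by omega),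
      mul_zero]

/-- `∂_2` of `contact` over `𝔽₂`. [folklore] -/
lemma pd2_contact : pd 2 (ser 2 contact) = (X 2 ^ 6 : MvPowerSeries (Fin 4) (ZMod 2)) := by
  ext A
  rw [coeff_pd_ser, coeff_ser, clean_contact, coeff_X_pow]
  have e0 : (A + Finsupp.single (2 : Fin 4) 1 : Fin 4 →₀ ℕ) 0 = A 0 := by simp
  have e1 : (A + Finsupp.single (2 : Fin 4) 1 : Fin 4 →₀ ℕ) 1 = A 1 := by simp
  have e2 : (A + Finsupp.single (2 : Fin 4) 1 : Fin 4 →₀ ℕ) 2 = A 2 + 1 := by simp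
  have e3 : (A + Finsupp.single (2 : Fin 4) 1 : Fin 4 →₀ ℕ) 3 = A 3 := by simp
  have hT0 : A = Finsupp.single (2 : Fin 4) 6 ↔ A 0 = 0 ∧ A 1 = 0 ∧ A 2 = 6 ∧ A 3 = 0 := by
    constructor
    · intro h; subst h; simp
    · rintro ⟨h0, h1, h2, h3⟩; ext j; fin_cases j <;> simp [h0, h1, h2, h3]
  unfold contact
  simp only [e0, e1, e2, e3]
  by_cases hc0 : A 0 = 0 ∧ A 1 = 0 ∧ A 2 = 6 ∧ A 3 = 0
  · rw [if_pos (hT0.mpr hc0),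
      if_neg (show ¬ (A 0 = 0 ∧ A 1 = 0 ∧ A 2 + 1 = 0 ∧ A 3 = 5) by omega),
      if_neg (show ¬ (A 0 = 0 ∧ A 1 = 0 ∧ A 2 + 1 = 2 ∧ A 3 = 1) by omega),
      if_pos (show A 0 = 0 ∧ A 1 = 0 ∧ A 2 + 1 = 7 ∧ A 3 = 0 by omega)]
    rw [show A 2 = 6 by omega]; decide
  · by_cases hc1 : A 0 = 0 ∧ A 1 = 0 ∧ A 2 = 1 ∧ A 3 = 1
    · rw [if_neg (show ¬ (A = Finsupp.single (2 : Fin 4) 6) from fun h' => by have := hT0.mp h'; omega),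
        if_neg (show ¬ (A 0 = 0 ∧ A 1 = 0 ∧ A 2 + 1 = 0 ∧ A 3 = 5) by omega),
        if_pos (show A 0 = 0 ∧ A 1 = 0 ∧ A 2 + 1 = 2 ∧ A 3 = 1 by omega)]
      rw [show A 2 = 1 by omega]; decide
    · rw [if_neg (show ¬ (A = Finsupp.single (2 : Fin 4) 6) from fun h' => by have := hT0.mp h'; omega),
        if_neg (show ¬ (A 0 = 0 ∧ A 1 = 0 ∧ A 2 + 1 = 0 ∧ A 3 = 5) by omega),
        if_neg (show ¬ (A 0 = 0 ∧ A 1 = 0 ∧ A 2 + 1 = 2 ∧ A 3 = 1) by omega),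
        if_neg (show ¬ (A 0 = 0 ∧ A 1 = 0 ∧ A 2 + 1 = 7 ∧ A 3 = 0) by omega),
        if_neg (show ¬ (A 0 = 1 ∧ A 1 = 1 ∧ A 2 + 1 = 0 ∧ A 3 = 0) by omega),
        mul_zero]

/-- `∂_3` of `contact` over `𝔽₂`. [folklore] -/
lemma pd3_contact : pd 3 (ser 2 contact) = (X 3 ^ 4 : MvPowerSeries (Fin 4) (ZMod 2)) + X 2 ^ 2 := by
  ext A
  rw [coeff_pd_ser, coeff_ser, clean_contact, map_add, coeff_X_pow, coeff_X_pow]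
  have e0 : (A + Finsupp.single (3 : Fin 4) 1 : Fin 4 →₀ ℕ) 0 = A 0 := by simp
  have e1 : (A + Finsupp.single (3 : Fin 4) 1 : Fin 4 →₀ ℕ) 1 = A 1 := by simp
  have e2 : (A + Finsupp.single (3 : Fin 4) 1 : Fin 4 →₀ ℕ) 2 = A 2 := by simp
  have e3 : (A + Finsupp.single (3 : Fin 4) 1 : Fin 4 →₀ ℕ) 3 = A 3 + 1 := by simp
  have hT0 : A = Finsupp.single (3 : Fin 4) 4 ↔ A 0 = 0 ∧ A 1 = 0 ∧ A 2 = 0 ∧ A 3 = 4 := by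
    constructor
    · intro h; subst h; simp
    · rintro ⟨h0, h1, h2, h3⟩; ext j; fin_cases j <;> simp [h0, h1, h2, h3]
  have hT1 : A = Finsupp.single (2 : Fin 4) 2 ↔ A 0 = 0 ∧ A 1 = 0 ∧ A 2 = 2 ∧ A 3 = 0 := by
    constructor
    · intro h; subst h; simp
    · rintro ⟨h0, h1, h2, h3⟩; ext j; fin_cases j <;> simp [h0, h1, h2, h3]
  unfold contact
  simp only [e0, e1, e2, e3]
  by_cases hc0 : A 0 = 0 ∧ A 1 = 0 ∧ A 2 = 0 ∧ A 3 = 4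
  · rw [if_pos (hT0.mpr hc0),
      if_neg (show ¬ (A = Finsupp.single (2 : Fin 4) 2) from fun h' => by have := hT1.mp h'; omega),
      if_pos (show A 0 = 0 ∧ A 1 = 0 ∧ A 2 = 0 ∧ A 3 + 1 = 5 by omega)]
    rw [show A 3 = 4 by omega]; decide
  · by_cases hc1 : A 0 = 0 ∧ A 1 = 0 ∧ A 2 = 2 ∧ A 3 = 0
    · rw [if_neg (show ¬ (A = Finsupp.single (3 : Fin 4) 4) from fun h' => by have := hT0.mp h'; omega),
        if_pos (hT1.mpr hc1),
        if_neg (show ¬ (A 0 = 0 ∧ A 1 = 0 ∧ A 2 = 0 ∧ A 3 + 1 = 5) by omega),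
        if_pos (show A 0 = 0 ∧ A 1 = 0 ∧ A 2 = 2 ∧ A 3 + 1 = 1 by omega)]
      rw [show A 3 = 0 by omega]; decide
    · rw [if_neg (show ¬ (A = Finsupp.single (3 : Fin 4) 4) from fun h' => by have := hT0.mp h'; omega),
        if_neg (show ¬ (A = Finsupp.single (2 : Fin 4) 2) from fun h' => by have := hT1.mp h'; omega),
        if_neg (show ¬ (A 0 = 0 ∧ A 1 = 0 ∧ A 2 = 0 ∧ A 3 + 1 = 5) by omega),
        if_neg (show ¬ (A 0 = 0 ∧ A 1 = 0 ∧ A 2 = 2 ∧ A 3 + 1 = 1) by omega),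
        if_neg (show ¬ (A 0 = 0 ∧ A 1 = 0 ∧ A 2 = 7 ∧ A 3 + 1 = 0) by omega),
        if_neg (show ¬ (A 0 = 1 ∧ A 1 = 1 ∧ A 2 = 0 ∧ A 3 + 1 = 0) by omega),
        mul_zero,
        add_zero]

/-- The order of `contact` is at least `2` (it is `2`). [folklore] -/
lemma two_le_ord_contact : 2 ≤ ord contact := by
  unfold ord
  apply le_csInf
  · refine ⟨2, ![1, 1, 0, 0], (contact_ne_zero_iff _).mpr ?_, ?_⟩
    · right; right; right; simp
    · simp [Fin.sum_univ_four]
  · rintro m ⟨A, hA, rfl⟩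
    rw [Fin.sum_univ_four]
    rcases (contact_ne_zero_iff A).mp hA with h | h | h | h <;> omega

/-- `contact` has multiplicity `2`. [folklore] -/
lemma multP_contact : (∃ A, clean 2 contact A ≠ 0) ∧
    ∀ A, clean 2 contact A ≠ 0 → 2 ≤ Finset.sum Finset.univ (fun j => A j) := by
  rw [clean_contact]
  refine ⟨⟨![1, 1, 0, 0], (contact_ne_zero_iff _).mpr (by right; right; right; simp)⟩, ?_⟩
  intro A hA
  rw [Fin.sum_univ_four]
  rcases (contact_ne_zero_iff A).mp hA with h | h | h | h <;> omega

/-- The tangent cone of `contact` is the contact form `u₁u₂`. [folklore] -/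
lemma cone_contact : cone 2 contact = (MvPolynomial.X 0 * MvPolynomial.X 1 : MvPolynomial (Fin 4) (ZMod 2)) := by
  unfold cone
  rw [Finset.sum_eq_single (![1, 1, 0, 0] : Fin 4 → ℕ)]
  · rw [if_pos (by simp [Fin.sum_univ_four]), clean_contact]
    have hc : contact ![1, 1, 0, 0] = 1 := by
      unfold contact; simp
    have hE : Finsupp.equivFunOnFinite.symm (![1, 1, 0, 0] : Fin 4 → ℕ) =
        Finsupp.single 0 1 + Finsupp.single 1 1 := by
      ext j; fin_cases j <;> simp
    rw [hc, hE, MvPolynomial.X, MvPolynomial.X, MvPolynomial.monomial_mul, one_mul]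
  · intro B _ hne
    by_cases hs : Finset.sum Finset.univ (fun j => B j) = 2
    · rw [if_pos hs, clean_contact]
      have hB : contact B = 0 := by
        by_contra hcon
        rw [Fin.sum_univ_four] at hs
        rcases (contact_ne_zero_iff B).mp hcon with h | h | h | h
        · omega
        · omega
        · omega
        · exact hne (funext fun j => by fin_cases j <;> simp [h.1, h.2.1, h.2.2.1, h.2.2.2])
      rw [hB, map_zero]
    · rw [if_neg hs]
  · intro h
    exact absurd (Fintype.mem_piFinset.mpr fun j => by fin_cases j <;> simp) h

/-- `e₃ = (0,0,1,0)` and `e₄ = (0,0,0,1)` lie in the cone-invariance space of `contact`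
(`u₁u₂` does not involve `u₃, u₄`). [folklore] -/
lemma basis_mem_Linv_contact (v : Fin 4 → ZMod 2) (h0 : v 0 = 0) (h1 : v 1 = 0) :
    v ∈ Linv 2 contact := by
  unfold Linv
  rw [Set.mem_setOf_eq, cone_contact]
  simp [h0, h1]

/-- Hence `dL contact ≥ 2` (in fact `= 2`). [folklore] -/
lemma two_le_dL_contact : 2 ≤ dL 2 contact := by
  let b : Fin 2 → (Fin 4 → ZMod 2) := ![Pi.single 2 1, Pi.single 3 1]
  have hli : LinearIndependent (ZMod 2) b := by
    refine LinearIndependent.pair_iff.mpr fun s t hst => ?_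
    have h2 := congrFun hst 2
    have h3 := congrFun hst 3
    simp at h2 h3
    exact ⟨h2, h3⟩
  have hsub : Set.range b ⊆ Linv 2 contact := by
    rintro _ ⟨k, rfl⟩
    fin_cases k
    · exact basis_mem_Linv_contact _ (by simp [b]) (by simp [b])
    · exact basis_mem_Linv_contact _ (by simp [b]) (by simp [b])
  unfold dL
  calc 2 = Module.finrank (ZMod 2) (Submodule.span (ZMod 2) (Set.range b)) := by
        rw [finrank_span_eq_card hli]; simp
    _ ≤ Module.finrank (ZMod 2) (Submodule.span (ZMod 2) (Linv 2 contact)) :=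
        Submodule.finrank_mono (Submodule.span_mono hsub)

/-- **`contact` is ISOLATED**: `∂a = (u₂, u₁, u₃⁶, u₄⁴ + u₃²)`; with `g = u₄⁴ + u₃²`,
`u₄¹² = g·(g² - 3g·u₃² + 3u₃⁴) - u₃⁶`, so `X_k ^ 12 ∈ (∂a)` for every `k`. [folklore] -/
lemma isol_contact : Module.Finite (ZMod 2) (MvPowerSeries (Fin 4) (ZMod 2) ⧸ jac 2 contact) := by
  have hJ : ∀ k : Fin 4, pd k (ser 2 contact) ∈ jac 2 contact := fun k => Ideal.subset_span ⟨k, rfl⟩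
  have h0 : (X 1 : MvPowerSeries (Fin 4) (ZMod 2)) ∈ jac 2 contact := pd0_contact ▸ hJ 0
  have h1 : (X 0 : MvPowerSeries (Fin 4) (ZMod 2)) ∈ jac 2 contact := pd1_contact ▸ hJ 1
  have h2 : (X 2 : MvPowerSeries (Fin 4) (ZMod 2)) ^ 6 ∈ jac 2 contact := pd2_contact ▸ hJ 2
  have h3 : (X 3 : MvPowerSeries (Fin 4) (ZMod 2)) ^ 4 + X 2 ^ 2 ∈ jac 2 contact := pd3_contact ▸ hJ 3
  apply module_finite_quotient_of_X_pow_mem _ 12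
  intro k
  fin_cases k
  · show (X 0 : MvPowerSeries (Fin 4) (ZMod 2)) ^ 12 ∈ jac 2 contact
    rw [show (X 0 : MvPowerSeries (Fin 4) (ZMod 2)) ^ 12 = X 0 ^ 11 * X 0 from by ring]
    exact Ideal.mul_mem_left _ _ h1
  · show (X 1 : MvPowerSeries (Fin 4) (ZMod 2)) ^ 12 ∈ jac 2 contact
    rw [show (X 1 : MvPowerSeries (Fin 4) (ZMod 2)) ^ 12 = X 1 ^ 11 * X 1 from by ring]
    exact Ideal.mul_mem_left _ _ h0
  · show (X 2 : MvPowerSeries (Fin 4) (ZMod 2)) ^ 12 ∈ jac 2 contact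
    rw [show (X 2 : MvPowerSeries (Fin 4) (ZMod 2)) ^ 12 = X 2 ^ 6 * X 2 ^ 6 from by ring]
    exact Ideal.mul_mem_left _ _ h2
  · show (X 3 : MvPowerSeries (Fin 4) (ZMod 2)) ^ 12 ∈ jac 2 contact
    rw [show (X 3 : MvPowerSeries (Fin 4) (ZMod 2)) ^ 12 =
      ((X 3 ^ 4 + X 2 ^ 2) ^ 2 - 3 * (X 3 ^ 4 + X 2 ^ 2) * X 2 ^ 2 + 3 * X 2 ^ 4) * (X 3 ^ 4 + X 2 ^ 2)
        - X 2 ^ 6 from by ring]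
    exact Ideal.sub_mem _ (Ideal.mul_mem_left _ _ h3) h2

end Summit.ResolutionOfSingularities.ResolutionOfSingularities.Theorems.ConeExit.Negative

end
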